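import Literature.NumberTheory.DiophantineGeometry.AbcExceptionalSetBounds
import Literature.NumberTheory.DiophantineGeometry.AbcHitCountUpperBoundProofs
import HarnessLib

/-!
# The trivial bound `N_λ(X) ≪_ε X ^ (2λ/3 + ε)` for every exponent `λ`, and what it gives
towards Theorem 1.3 of Bernert–Browning–Lichtman–Teräväinen

Companion ("Proofs") file of `Literature.NumberTheory.DiophantineGeometry.AbcExceptionalSetBounds`
(the counting function `abcExponentCount λ X = N_λ(X)` and the named facts
`bernertEtAl2024_thm_1_2`, `bernertEtAl2024_thm_1_3`). Nothing there is restated or changed; this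
file only adds proofs.

## What is proved

* `bernertEtAl2024_prop_1_1` — **Proposition 1.1** of the source, for *every* real exponent
  `λ > 0`: for all `ε > 0` there is `C` with `N_λ(X) ≤ C · X ^ (2λ/3 + ε)` for all `X ≥ 2`.
  (`AbcHitCountUpperBoundProofs` proves the case `λ = 1`, i.e. `ABCHitCountUpperBound`; the
  argument is the same and its Rankin-trick lemmas `AbcHits.card_radFibre_le`,
  `AbcHits.pow_three_le_sq_of_le` are reused.) Proof, as sketched in [BernertEtAl2024, §1]: for a
  triple counted by `N_λ(X)` the numbers `a, b, c` are pairwise coprime, so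
  `rad a · rad b · rad c = rad(abc) < c ^ λ ≤ X ^ λ`, hence the two members `u, v` with the smallest
  radicals satisfy `(rad u · rad v)³ ≤ (rad a · rad b · rad c)² < X ^ (2λ)`, and the triple is
  recovered from `u, v`; so `N_λ(X) ≤ 3 · #{(u, v) ∈ [1, X]² : (rad u · rad v)³ < X ^ (2λ)}`.
  Fibring over `(r, s) = (rad u, rad v)` (a point under the hyperbola `r s < X ^ (2λ/3)`, at most
  `X ^ (2λ/3) (1 + log X)` of them) and bounding each radical fibre by `K_δ X ^ (2δ)` gives
  `N_λ(X) ≤ 3 K_δ² (1 + 1/δ) X ^ (2λ/3 + 5δ)`; take `δ = ε/5`. The real threshold `X ^ (2λ)` is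
  handled through the integer `⌈(X ^ λ)²⌉₊` (`Nat.lt_ceil`), so all finite sets stay decidable.
* Consequences for the named fact `bernertEtAl2024_thm_1_3` ("`N_λ(X) ≪_{ε,λ} X ^ (0.6 + ε)` for
  `λ ∈ (0, 1)`", [BernertEtAl2024, Thm. 1.3 (arXiv v2)]), which is NOT proved here:
  - `abcExponentCount_le_three_fifths_of_le` — its conclusion holds unconditionally for
    `λ ≤ 9/10` (as `2λ/3 ≤ 3/5`);
  - `bernertEtAl2024_thm_1_2.thm_1_3_of_le` — and for `λ ≤ 21/23` from Theorem 1.2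
    (`(23λ + 3)/40 ≤ 3/5`);
  - `bernertEtAl2024_thm_1_3_of_near_one` — by monotonicity of `N_λ` in `λ`, Theorem 1.3 follows
    from its restriction to any terminal segment `λ ∈ [λ₀, 1)`; the content of the theorem is the
    range `λ → 1⁻`, where the source uses a Fourier-analytic moment bound, the geometry of
    numbers and a mixed-integer linear programme (Props. 3.1, 4.1, 6.1 of arXiv v2), none of
    which is reproduced in this file.

## References

* [BernertEtAl2024] C. Bernert, T. Browning, J. D. Lichtman, J. Teräväinen, *Bounds on the
  exceptional set in the abc conjecture*, arXiv:2410.12234: v1 (16 Oct 2024) Proposition 1.1,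
  eq. (1.1); v2 (9 May 2026) Proposition 1.1, Theorems 1.2, 1.3.
* [Bernert2025] C. Bernert, *The exceptional set in the abc conjecture*, arXiv:2506.13364 (2025),
  §1 (the trivial bound `N_λ(X) ≪ X ^ (2λ/3 + ε)` quoted from [BLT]).
-/

noncomputable section

open UniqueFactorizationMonoid Finset

namespace Literature.NumberTheory.DiophantineGeometry

namespace AbcHits

/-! ### Pairs with small radical product below a general threshold `B` -/

/-- For an abc triple `(a, b, c)` with `c ≤ X` and `rad(abc)² < B`, the two members with the
smallest radicals form a pair `(u, v) ∈ [1, X]²` with `(rad u · rad v)³ < B` (pairwise coprimality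
gives `rad a · rad b · rad c = rad(abc)`, and `(xy)³ ≤ (xyz)²` for `x, y ≤ z`). The case `B = X²`
is `AbcHits.hit_mem_smallRadPairs`. [folklore] -/
theorem triple_mem_smallRadPairs {X B a b c : ℕ} {S : Finset (ℕ × ℕ)}
    (hS : {q ∈ Icc 1 X ×ˢ Icc 1 X | (radical q.1 * radical q.2) ^ 3 < B} = S)
    (ht : IsABCTriple a b c) (hcX : c ≤ X) (hrad : rad a b c ^ 2 < B) :
    (b, c) ∈ S ∨ (a, c) ∈ S ∨ (a, b) ∈ S := by
  subst hS
  obtain ⟨ha, hb, habc, hcop⟩ := ht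
  have hac : Nat.Coprime a c := by rw [← habc]; exact Nat.coprime_self_add_right.mpr hcop
  have hbc : Nat.Coprime b c := by rw [← habc]; exact Nat.coprime_add_self_right.mpr hcop.symm
  have hprod : rad a b c = radical a * radical b * radical c := by
    rw [rad_def, radical_mul (Nat.coprime_iff_isRelPrime.mp
      (Nat.coprime_mul_iff_left.mpr ⟨hac, hbc⟩)), radical_mul (Nat.coprime_iff_isRelPrime.mp hcop)]
  have hsq : (radical a * radical b * radical c) ^ 2 < B := by rwa [← hprod]
  have haI : a ∈ Icc 1 X := mem_Icc.mpr ⟨ha, by omega⟩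
  have hbI : b ∈ Icc 1 X := mem_Icc.mpr ⟨hb, by omega⟩
  have hcI : c ∈ Icc 1 X := mem_Icc.mpr ⟨by omega, hcX⟩
  simp only [mem_filter, mem_product]
  rcases le_total (radical a) (radical b) with hab | hba
  · rcases le_total (radical b) (radical c) with hbc' | hcb
    · exact Or.inr (Or.inr ⟨⟨haI, hbI⟩,
        lt_of_le_of_lt (pow_three_le_sq_of_le (hab.trans hbc') hbc') hsq⟩)
    · refine Or.inr (Or.inl ⟨⟨haI, hcI⟩, lt_of_le_of_lt ?_ hsq⟩)
      calc (radical a * radical c) ^ 3 ≤ (radical a * radical c * radical b) ^ 2 :=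
            pow_three_le_sq_of_le hab hcb
        _ = (radical a * radical b * radical c) ^ 2 := by ring
  · rcases le_total (radical a) (radical c) with hac' | hca
    · exact Or.inr (Or.inr ⟨⟨haI, hbI⟩,
        lt_of_le_of_lt (pow_three_le_sq_of_le hac' (hba.trans hac')) hsq⟩)
    · refine Or.inl ⟨⟨hbI, hcI⟩, lt_of_le_of_lt ?_ hsq⟩
      calc (radical b * radical c) ^ 3 ≤ (radical b * radical c * radical a) ^ 2 :=
            pow_three_le_sq_of_le hba hca
        _ = (radical a * radical b * radical c) ^ 2 := by ring

/-- Fibring the pairs `(u, v)` with `(rad u · rad v)³ < B` over `(r, s) = (rad u, rad v)`: each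
fibre lies in a product of two radical fibres. The case `B = X²` is
`AbcHits.card_smallRadPairs_le`. [folklore] -/
theorem card_smallRadPairs_le_of_lt (X B : ℕ) :
    #{q ∈ Icc 1 X ×ˢ Icc 1 X | (radical q.1 * radical q.2) ^ 3 < B} ≤
      ∑ q ∈ {q ∈ Icc 1 X ×ˢ Icc 1 X | (q.1 * q.2) ^ 3 < B},
        #{u ∈ Icc 1 X | radical u = q.1} * #{u ∈ Icc 1 X | radical u = q.2} := by
  classical
  have hmaps : Set.MapsTo (fun q : ℕ × ℕ => (radical q.1, radical q.2))
      ({q ∈ Icc 1 X ×ˢ Icc 1 X | (radical q.1 * radical q.2) ^ 3 < B} : Finset (ℕ × ℕ))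
      ({q ∈ Icc 1 X ×ˢ Icc 1 X | (q.1 * q.2) ^ 3 < B} : Finset (ℕ × ℕ)) := by
    intro q hq
    obtain ⟨hqI, hlt⟩ := mem_filter.mp (mem_coe.mp hq)
    rw [mem_product, mem_Icc, mem_Icc] at hqI
    obtain ⟨⟨h1, h1X⟩, ⟨h2, h2X⟩⟩ := hqI
    refine mem_coe.mpr (mem_filter.mpr ⟨mem_product.mpr ⟨mem_Icc.mpr ⟨?_, ?_⟩,
      mem_Icc.mpr ⟨?_, ?_⟩⟩, hlt⟩)
    · exact Nat.succ_le_of_lt (Nat.radical_pos _)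
    · exact (Nat.radical_le_self_iff.mpr (by omega)).trans h1X
    · exact Nat.succ_le_of_lt (Nat.radical_pos _)
    · exact (Nat.radical_le_self_iff.mpr (by omega)).trans h2X
  rw [card_eq_sum_card_fiberwise hmaps]
  refine sum_le_sum (fun q _ => ?_)
  obtain ⟨r, s⟩ := q
  rw [← card_product]
  refine card_le_card (fun u hu => ?_)
  simp only [mem_filter, mem_product, Prod.mk.injEq] at hu ⊢
  obtain ⟨⟨⟨hu1, hu2⟩, -⟩, hr, hs⟩ := hu
  exact ⟨⟨hu1, hr⟩, ⟨hu2, hs⟩⟩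

/-- **Hyperbola count below a real threshold**: if every integer `n < B` satisfies `n < Y³`
(e.g. `B = ⌈Y³⌉₊`), then `#{(r, s) ∈ [1, X]² : (rs)³ < B} ≤ Y (1 + log X)`, summing
`#{s : s < Y / r} ≤ Y / r` over `r ≤ X` with `harmonic_le_one_add_log`. The case `Y = X ^ (2/3)`,
`B = X²` is `AbcHits.card_hyperbolaPairs_le`. [folklore] -/
theorem card_hyperbolaPairs_le_of_lt (X B : ℕ) {Y : ℝ} (hY0 : 0 ≤ Y)
    (hB : ∀ n : ℕ, n < B → (n : ℝ) < Y ^ 3) :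
    (#{q ∈ Icc 1 X ×ˢ Icc 1 X | (q.1 * q.2) ^ 3 < B} : ℝ) ≤ Y * (1 + Real.log X) := by
  classical
  generalize hT : {q ∈ Icc 1 X ×ˢ Icc 1 X | (q.1 * q.2) ^ 3 < B} = T
  have hmemT : ∀ q ∈ T, q.2 ∈ Icc 1 X ∧ (q.1 * q.2) ^ 3 < B := by
    intro q hq
    rw [← hT] at hq
    obtain ⟨hqI, hlt⟩ := mem_filter.mp hq
    exact ⟨(mem_product.mp hqI).2, hlt⟩
  have hmaps : Set.MapsTo (Prod.fst : ℕ × ℕ → ℕ) (T : Set (ℕ × ℕ)) (Icc 1 X : Set ℕ) := by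
    intro q hq
    rw [mem_coe, ← hT] at hq
    exact mem_coe.mpr (mem_product.mp (mem_filter.mp hq).1).1
  rw [card_eq_sum_card_fiberwise hmaps]
  push_cast
  have hfib : ∀ r ∈ Icc 1 X, ((T.filter (fun q => q.1 = r)).card : ℝ) ≤ Y / r := by
    intro r hr
    obtain ⟨hr1, -⟩ := mem_Icc.mp hr
    have hr0 : (0 : ℝ) < r := by exact_mod_cast hr1
    have hcard : (T.filter (fun q => q.1 = r)).card ≤ (Icc 1 ⌊Y / r⌋₊).card := by
      refine card_le_card_of_injOn Prod.snd (fun q hq => ?_) (fun q hq q' hq' h => ?_)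
      · obtain ⟨hqT, hq1⟩ := mem_filter.mp (mem_coe.mp hq)
        obtain ⟨hs, hlt⟩ := hmemT q hqT
        refine mem_coe.mpr (mem_Icc.mpr ⟨(mem_Icc.mp hs).1, Nat.le_floor ?_⟩)
        rw [le_div_iff₀ hr0]
        have h3 : ((q.1 * q.2 : ℕ) : ℝ) ^ 3 < Y ^ 3 := by exact_mod_cast hB _ hlt
        have hlt' : ((q.1 * q.2 : ℕ) : ℝ) < Y := lt_of_pow_lt_pow_left₀ 3 hY0 h3
        rw [hq1] at hlt'
        push_cast at hlt'
        linarith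
      · exact Prod.ext ((mem_filter.mp (mem_coe.mp hq)).2.trans
          (mem_filter.mp (mem_coe.mp hq')).2.symm) h
    have hcard' : (T.filter (fun q => q.1 = r)).card ≤ ⌊Y / r⌋₊ := by
      simpa [Nat.card_Icc] using hcard
    calc ((T.filter (fun q => q.1 = r)).card : ℝ) ≤ (⌊Y / r⌋₊ : ℝ) := by exact_mod_cast hcard'
      _ ≤ Y / r := Nat.floor_le (by positivity)
  calc ∑ r ∈ Icc 1 X, ((T.filter (fun q => q.1 = r)).card : ℝ)
      ≤ ∑ r ∈ Icc 1 X, Y / r := sum_le_sum hfib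
    _ = Y * ∑ r ∈ Icc 1 X, ((r : ℝ))⁻¹ := by rw [mul_sum]; rfl
    _ = Y * (harmonic X : ℝ) := by rw [harmonic_eq_sum_Icc]; push_cast; rfl
    _ ≤ Y * (1 + Real.log X) := mul_le_mul_of_nonneg_left (harmonic_le_one_add_log X) hY0

/-! ### Triples of exponent `λ` -/

/-- For `λ ≥ 0`, a triple with `c ≤ X` and `rad(abc) < c ^ λ` has `rad(abc)² < ⌈(X ^ λ)²⌉₊`
(as `c ^ λ ≤ X ^ λ`, squaring, and `Nat.lt_ceil`). [folklore] -/
theorem rad_sq_lt_ceil {l : ℝ} (hl : 0 ≤ l) {X a b c : ℕ} (hcX : c ≤ X)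
    (hrad : ((rad a b c : ℕ) : ℝ) < (c : ℝ) ^ l) :
    rad a b c ^ 2 < ⌈((X : ℝ) ^ l) ^ 2⌉₊ := by
  rw [Nat.lt_ceil]
  push_cast
  have h0 : (0 : ℝ) ≤ (rad a b c : ℕ) := Nat.cast_nonneg _
  have hcX' : (c : ℝ) ^ l ≤ (X : ℝ) ^ l :=
    Real.rpow_le_rpow (Nat.cast_nonneg _) (by exact_mod_cast hcX) hl
  have h1 : ((rad a b c : ℕ) : ℝ) < (X : ℝ) ^ l := hrad.trans_le hcX'
  rw [sq, sq]
  exact mul_lt_mul'' h1 h1 h0 h0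

/-- **Three injections**, exponent version: for `λ ≥ 0`, an abc triple of exponent `λ` up to `X`
is determined by any two of its members, and the two with the smallest radicals lie in
`{(u, v) ∈ [1, X]² : (rad u · rad v)³ < ⌈(X ^ λ)²⌉₊}`; so `N_λ(X)` is at most three times the
size of that set. The case `λ = 1` is `AbcHits.card_hits_le`. [folklore] -/
theorem card_exponentTriples_le {l : ℝ} (hl : 0 ≤ l) (X : ℕ) :
    (abcExponentCount_finite l X).toFinset.card ≤
      3 * #{q ∈ Icc 1 X ×ˢ Icc 1 X |
        (radical q.1 * radical q.2) ^ 3 < ⌈((X : ℝ) ^ l) ^ 2⌉₊} := by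
  classical
  generalize hS : {q ∈ Icc 1 X ×ˢ Icc 1 X |
    (radical q.1 * radical q.2) ^ 3 < ⌈((X : ℝ) ^ l) ^ 2⌉₊} = S
  set H := (abcExponentCount_finite l X).toFinset with hH
  have hmem : ∀ t ∈ H, IsABCTriple t.1 t.2.1 t.2.2 ∧ t.2.2 ≤ X ∧
      ((rad t.1 t.2.1 t.2.2 : ℕ) : ℝ) < (t.2.2 : ℝ) ^ l := by
    intro t ht
    simpa [hH, Set.Finite.mem_toFinset] using ht
  have hkey : ∀ t ∈ H, (t.2.1, t.2.2) ∈ S ∨ (t.1, t.2.2) ∈ S ∨ (t.1, t.2.1) ∈ S := by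
    intro t ht
    obtain ⟨htr, hcX, hrad⟩ := hmem t ht
    exact triple_mem_smallRadPairs hS htr hcX (rad_sq_lt_ceil hl hcX hrad)
  -- an injection-on-triples bound, applied to the three coordinate projections
  have hbound : ∀ f : ℕ × ℕ × ℕ → ℕ × ℕ,
      (∀ t t' : ℕ × ℕ × ℕ, t.1 + t.2.1 = t.2.2 → t'.1 + t'.2.1 = t'.2.2 → f t = f t' → t = t') →
      (H.filter (fun t => f t ∈ S)).card ≤ S.card := by
    intro f hf
    refine card_le_card_of_injOn f (fun t ht => ?_) (fun t ht t' ht' h => ?_)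
    · exact (mem_filter.mp (mem_coe.mp ht)).2
    · have h1 := (hmem t (mem_filter.mp (mem_coe.mp ht)).1).1.2.2.1
      have h2 := (hmem t' (mem_filter.mp (mem_coe.mp ht')).1).1.2.2.1
      exact hf t t' h1 h2 h
  set f₁ : ℕ × ℕ × ℕ → ℕ × ℕ := fun t => (t.2.1, t.2.2) with hf₁
  set f₂ : ℕ × ℕ × ℕ → ℕ × ℕ := fun t => (t.1, t.2.2) with hf₂
  set f₃ : ℕ × ℕ × ℕ → ℕ × ℕ := fun t => (t.1, t.2.1) with hf₃
  have h₁ : (H.filter (fun t => f₁ t ∈ S)).card ≤ S.card := hbound f₁ (fun t t' h h' hf => by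
    simp only [hf₁, Prod.mk.injEq] at hf
    exact Prod.ext (by omega) (Prod.ext hf.1 hf.2))
  have h₂ : (H.filter (fun t => f₂ t ∈ S)).card ≤ S.card := hbound f₂ (fun t t' h h' hf => by
    simp only [hf₂, Prod.mk.injEq] at hf
    exact Prod.ext hf.1 (Prod.ext (by omega) hf.2))
  have h₃ : (H.filter (fun t => f₃ t ∈ S)).card ≤ S.card := hbound f₃ (fun t t' h h' hf => by
    simp only [hf₃, Prod.mk.injEq] at hf
    exact Prod.ext hf.1 (Prod.ext hf.2 (by omega)))
  have hcover : H ⊆ H.filter (fun t => f₁ t ∈ S) ∪ H.filter (fun t => f₂ t ∈ S) ∪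
      H.filter (fun t => f₃ t ∈ S) := by
    intro t ht
    rcases hkey t ht with h | h | h
    · exact mem_union_left _ (mem_union_left _ (mem_filter.mpr ⟨ht, h⟩))
    · exact mem_union_left _ (mem_union_right _ (mem_filter.mpr ⟨ht, h⟩))
    · exact mem_union_right _ (mem_filter.mpr ⟨ht, h⟩)
  have hunion := (card_le_card hcover).trans ((card_union_le _ _).trans
    (Nat.add_le_add_right (card_union_le _ _) _))
  omega

end AbcHits

/-! ### Proposition 1.1 for every exponent -/

open AbcHits in
/-- **Bernert–Browning–Lichtman–Teräväinen, Proposition 1.1** (the "trivial bound"), for every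
real exponent: "Let `λ > 0`. Then `N_λ(X) = O_ε(X ^ (2λ/3 + ε))`, for any `ε > 0`." Rendered as
`∃ C, ∀ X ≥ 2, N_λ(X) ≤ C · X ^ (2λ/3 + ε)`; the constant produced is `3 K² (1 + 5/ε)` with
`K = K_{ε/5}` from `AbcHits.card_radFibre_le` (two smallest radicals, then Rankin's trick for the
integers with a prescribed radical, in place of de Bruijn's estimate (1.1) of the source). The case
`λ = 1` is `ABCHitCountUpperBound_holds`. [cite: BernertEtAl2024, Proposition 1.1] -/
theorem bernertEtAl2024_prop_1_1 {l : ℝ} (hl : 0 < l) {ε : ℝ} (hε : 0 < ε) :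
    ∃ C : ℝ, ∀ X : ℕ, 2 ≤ X →
      (abcExponentCount l X : ℝ) ≤ C * (X : ℝ) ^ (2 * l / 3 + ε) := by
  set δ : ℝ := ε / 5 with hδdef
  have hδ : 0 < δ := by positivity
  obtain ⟨K, hK, hfib⟩ := card_radFibre_le hδ
  refine ⟨3 * (K ^ 2 * (1 + 1 / δ)), fun X hX => ?_⟩
  have hX0 : (0 : ℝ) < X := by exact_mod_cast (by omega : 0 < X)
  have hX1 : (1 : ℝ) ≤ X := by exact_mod_cast (by omega : 1 ≤ X)
  set E : ℝ := (X : ℝ) ^ δ with hE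
  have hE1 : 1 ≤ E := Real.one_le_rpow hX1 hδ.le
  set Y : ℝ := (X : ℝ) ^ (2 * l / 3) with hY
  have hY0 : 0 ≤ Y := by positivity
  have hY3 : ((X : ℝ) ^ l) ^ 2 = Y ^ 3 := by
    rw [hY, ← Real.rpow_natCast, ← Real.rpow_natCast, ← Real.rpow_mul hX0.le,
      ← Real.rpow_mul hX0.le]
    congr 1
    push_cast
    ring
  set B : ℕ := ⌈((X : ℝ) ^ l) ^ 2⌉₊ with hBdef
  have hB : ∀ n : ℕ, n < B → (n : ℝ) < Y ^ 3 := fun n hn => hY3 ▸ Nat.lt_ceil.mp hn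
  -- radical fibres over `r ≤ X` have at most `K E²` elements
  have hfibX : ∀ r : ℕ, 1 ≤ r → r ≤ X → (#{u ∈ Icc 1 X | radical u = r} : ℝ) ≤ K * E * E := by
    intro r hr hrX
    have hrδ : (r : ℝ) ^ δ ≤ E :=
      Real.rpow_le_rpow (by positivity) (by exact_mod_cast hrX) hδ.le
    calc (#{u ∈ Icc 1 X | radical u = r} : ℝ) ≤ K * (X : ℝ) ^ δ * (r : ℝ) ^ δ := hfib X r hr
      _ ≤ K * E * E := mul_le_mul_of_nonneg_left hrδ (by positivity)
  -- the pairs with small radical product and the points under the hyperbola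
  generalize hS : {q ∈ Icc 1 X ×ˢ Icc 1 X | (radical q.1 * radical q.2) ^ 3 < B} = S
  generalize hT : {q ∈ Icc 1 X ×ˢ Icc 1 X | (q.1 * q.2) ^ 3 < B} = T
  have h1 : (abcExponentCount l X : ℝ) ≤ 3 * S.card := by
    rw [abcExponentCount, Set.ncard_eq_toFinset_card _ (abcExponentCount_finite l X), ← hS]
    exact_mod_cast card_exponentTriples_le hl.le X
  have h2 : (S.card : ℝ) ≤ T.card * (K * E * E) ^ 2 := by
    calc (S.card : ℝ)
        ≤ ((∑ q ∈ T, #{u ∈ Icc 1 X | radical u = q.1} * #{u ∈ Icc 1 X | radical u = q.2} : ℕ)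
            : ℝ) := by
          rw [← hS, ← hT]; exact_mod_cast card_smallRadPairs_le_of_lt X B
      _ = ∑ q ∈ T, (#{u ∈ Icc 1 X | radical u = q.1} : ℝ) * #{u ∈ Icc 1 X | radical u = q.2} := by
          push_cast; rfl
      _ ≤ ∑ q ∈ T, (K * E * E) ^ 2 := by
          refine sum_le_sum (fun q hq => ?_)
          rw [← hT] at hq
          obtain ⟨hqI, -⟩ := mem_filter.mp hq
          rw [mem_product, mem_Icc, mem_Icc] at hqI
          obtain ⟨⟨h1r, hrX⟩, ⟨h1s, hsX⟩⟩ := hqI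
          rw [sq]
          exact mul_le_mul (hfibX _ h1r hrX) (hfibX _ h1s hsX) (by positivity) (by positivity)
      _ = T.card * (K * E * E) ^ 2 := by rw [sum_const, nsmul_eq_mul]
  have h3 : (T.card : ℝ) ≤ Y * (1 + Real.log X) := by
    rw [← hT]; exact card_hyperbolaPairs_le_of_lt X B hY0 hB
  have h4 : 1 + Real.log X ≤ (1 + 1 / δ) * E := by
    have hlog : Real.log X ≤ E / δ := Real.log_le_rpow_div hX0.le hδ
    calc 1 + Real.log X ≤ E + E / δ := add_le_add hE1 hlog
      _ = (1 + 1 / δ) * E := by ring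
  have hE5 : Y * E ^ 5 = (X : ℝ) ^ (2 * l / 3 + ε) := by
    rw [hY, hE, ← Real.rpow_natCast, ← Real.rpow_mul hX0.le, ← Real.rpow_add hX0]
    congr 1
    rw [hδdef]; push_cast; ring
  calc (abcExponentCount l X : ℝ) ≤ 3 * S.card := h1
    _ ≤ 3 * (T.card * (K * E * E) ^ 2) := by gcongr
    _ ≤ 3 * ((Y * (1 + Real.log X)) * (K * E * E) ^ 2) := by gcongr
    _ ≤ 3 * ((Y * ((1 + 1 / δ) * E)) * (K * E * E) ^ 2) := by gcongr
    _ = 3 * (K ^ 2 * (1 + 1 / δ)) * (Y * E ^ 5) := by ring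
    _ = 3 * (K ^ 2 * (1 + 1 / δ)) * (X : ℝ) ^ (2 * l / 3 + ε) := by rw [hE5]

/-! ### Consequences for Theorem 1.3 -/

/-- **Theorem 1.3 for `λ ≤ 9/10`, unconditionally**: since `2λ/3 ≤ 3/5` there, Proposition 1.1
already gives `N_λ(X) ≤ C · X ^ (3/5 + ε)` for `X ≥ 2`. (Theorem 1.3 itself,
`bernertEtAl2024_thm_1_3`, concerns all `λ < 1` and is not proved in this file.)
[cite: BernertEtAl2024, Proposition 1.1] -/
theorem abcExponentCount_le_three_fifths_of_le {l : ℝ} (hl : 0 < l) (hl1 : l ≤ 9 / 10) {ε : ℝ}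
    (hε : 0 < ε) :
    ∃ C : ℝ, ∀ X : ℕ, 2 ≤ X → (abcExponentCount l X : ℝ) ≤ C * (X : ℝ) ^ (3 / 5 + ε : ℝ) := by
  obtain ⟨C, hC⟩ := bernertEtAl2024_prop_1_1 hl hε
  exact ⟨max C 0, abcExponentCount_le_of_le le_rfl (by linarith) hC⟩

/-- **Theorem 1.3 for `λ ≤ 21/23`, from Theorem 1.2**: since `(23λ + 3)/40 ≤ 3/5` there, the
named fact `bernertEtAl2024_thm_1_2` gives `N_λ(X) ≤ C · X ^ (3/5 + ε)` for `X ≥ 2`.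
[cite: BernertEtAl2024, Thm. 1.2 (arXiv v2)] -/
theorem bernertEtAl2024_thm_1_2.thm_1_3_of_le (h : bernertEtAl2024_thm_1_2) {l : ℝ} (hl : 0 < l)
    (hl1 : l ≤ 21 / 23) {ε : ℝ} (hε : 0 < ε) :
    ∃ C : ℝ, ∀ X : ℕ, 2 ≤ X → (abcExponentCount l X : ℝ) ≤ C * (X : ℝ) ^ (3 / 5 + ε : ℝ) := by
  obtain ⟨C, hC⟩ := h l hl (by linarith) ε hε
  exact ⟨max C 0, abcExponentCount_le_of_le le_rfl (by linarith) hC⟩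

/-- **Reduction of Theorem 1.3 to exponents near `1`**: since `N_λ(X)` is monotone in `λ`
(`abcExponentCount_mono_left`), the bound `N_λ(X) ≪_{ε,λ} X ^ (0.6 + ε)` for all `λ` in a
terminal segment `[λ₀, 1)` implies it for every `λ < 1` (for `λ < λ₀` compare with `λ₀`); this is
how the source treats small `λ`. [cite: BernertEtAl2024, Thm. 1.3 (arXiv v2)] -/
theorem bernertEtAl2024_thm_1_3_of_near_one {l₀ : ℝ} (hl₀ : l₀ < 1)
    (h : ∀ l : ℝ, l₀ ≤ l → l < 1 → ∀ ε : ℝ, 0 < ε → ∃ C : ℝ, ∀ X : ℕ, 2 ≤ X →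
      (abcExponentCount l X : ℝ) ≤ C * (X : ℝ) ^ (3 / 5 + ε : ℝ)) :
    bernertEtAl2024_thm_1_3 := by
  intro l _ hl1 ε hε
  rcases le_total l₀ l with hle | hle
  · exact h l hle hl1 ε hε
  · obtain ⟨C, hC⟩ := h l₀ le_rfl hl₀ ε hε
    exact ⟨max C 0, abcExponentCount_le_of_le hle le_rfl hC⟩

end Literature.NumberTheory.DiophantineGeometry
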